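import Summits.CriticalPhenomena.PercolationContinuityZ3.Theorems.Transplant.FKConnectivityAllQAntipodalRootForm3BaseParE
import Summits.CriticalPhenomena.PercolationContinuityZ3.Theorems.Transplant.FKConnectivityAllQAntipodalRootForm3RealPivot
import Summits.CriticalPhenomena.PercolationContinuityZ3.Theorems.Transplant.FKConnectivityAllQAntipodalRootForm3EnvAnd
import Summits.CriticalPhenomena.PercolationContinuityZ3.Theorems.Transplant.FKConnectivityAllQAntipodalRootFormGeneral

/-!
# Connectivity correlation inequalities for `φ_{w,q}`, every `q > 0` — ROOT-FORM CALCULUS, file 74d: the REAL parallel 2+1 gluing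
# (`E₁ ∥ E₂` with `y, z ∈ E₁`, `w ∈ E₂`): the five facts of the generic word theorem for its real three-special environment

Support file (`--supports stmt-CriticalPhenomena-4575`), FK sub-lane `prim-bschramm-fk-2` (gen 32); builds on p205010 (kernel theorem,
internal audit signed; external expert review pending).  No definitions, no named facts, no sorries; standard axioms.  Memo
FROM-fk-2-g31-DUALITY.md §6 (G3)/(G4), §9 (ii)–(iv), FROM-fk-2-g32-*.md; FK-Q2 §41.

The base of the induction on `FK.IsParSplit` (file 74f).  `E₁, E₂` two-terminal series–parallel between `a, b`, edge-disjoint, vertex sets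
meeting only in the poles; specials `y, z ∈ E₁`, `w ∈ E₂`; cells `(M₁, C₁)` in `E₁ \ {y,z}` and `(M₂, C₂)` in `E₂ \ w`.
* `gcombPar_real_d` — the abstract three-special environment `Base3.gcombPar (realEnv M₁ C₁ a b y z) (realBox M₂ C₂ a b w)` (file 73a) IS the
  real environment `realEnv3 (M₁ ∪ M₂) (C₁ ∪ C₂) a b y z w` (file 74a) along `(β, γ) ↦ β ∪ γ`, every level raised by `2|V|`
  (`FK.RootForm.acomb_realSDat0` of file 61x = `FK.apExpC_parallel` + `FK.reachable_union_parallel`, pattern by pattern);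
* `realEnv3_par21_facts` — hence the FIVE FACTS for `realEnv3 (M₁ ∪ M₂) (C₁ ∪ C₂) a b y z w`: fact 1 = `Base3.gcombPar_gMt_nonneg` (73d, the
  kernel-checked GLUE(2,1)∥ certificate) and fact 2 = `Base3.gcombPar_parE_gMt_nonneg` (73e) with their hypotheses discharged for real data by
  files 61z (`isTTSP_realEnv_facts`: F1/F2/F4 of `E₁`), 74c (consistency into the 304, pivots Ucony/Uconz/Uexy) and 61m (box axioms of `E₂`),
  transported by `Gen.gtransfer_Mt/parE` (61γ); facts 3–5 = file 74p on `E₁ ∪ E₂`.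
[cite: Grimmett2006, §1.4 eq. (1.20) (p. 15); §3.8 Thm. (3.90) (pp. 61–62)] [cite: Wagner2006, Thm. 5.8(d), §5.3]
-/

noncomputable section

namespace Summit.CriticalPhenomena.PercolationContinuityZ3.Theorems

namespace FK

namespace RootForm

open SimpleGraph Finset Literature.Probability.LatticeModels Literature.Probability.Percolation
open scoped Classical

variable {V : Type*} [Fintype V]

section Data

variable {E₁ E₂ M₁ C₁ M₂ C₂ : Finset (Sym2 V)} {a b uy vy uz vz : V} {w : Sym2 V}

omit [Fintype V] in
/-- `comb3` is `acomb` with the box first. [folklore] -/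
theorem comb3_eq_acomb (d : PDat) (s : Base.SDat) : Base3.comb3 d s = acomb s d := by
  obtain ⟨l, k1, k2⟩ := d; obtain ⟨L, c, cb⟩ := s
  cases k1 <;> cases k2 <;> cases c <;> cases cb <;> simp [Base3.comb3, acomb, bit] <;> ring

omit [Fintype V] in
/-- `insIf` commutes with unions on the right. [folklore] -/
theorem insIf_union {p : Prop} [Decidable p] (e : Sym2 V) (X A : Finset (Sym2 V)) : insIf p e X ∪ A = insIf p e (X ∪ A) := by
  unfold insIf; split_ifs
  · exact Finset.insert_union _ _ _
  · rfl

omit [Fintype V] in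
/-- `insIf` stays inside the inserted cell. [folklore] -/
theorem insIf_subset_insert {p : Prop} [Decidable p] (e : Sym2 V) {X Y : Finset (Sym2 V)} (h : X ⊆ Y) : insIf p e X ⊆ insert e Y := by
  unfold insIf; split_ifs
  · exact Finset.insert_subset_insert _ h
  · exact h.trans (Finset.subset_insert _ _)

/-- the `E₁`-pattern data selected by a three-special pattern. [folklore] -/
theorem dq_realEnv_qOf (M C : Finset (Sym2 V)) (a b : V) (y z : Sym2 V) (β : ↥M.powerset) (P : Finset (Fin 3)) :
    Base3.dq (realEnv M C a b y z β) (Base3.qOf P) = realPDat M C a b y z (insIf ((0 : Fin 3) ∈ P) y (insIf ((1 : Fin 3) ∈ P) z β.1)) := by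
  by_cases h0 : (0 : Fin 3) ∈ P <;> by_cases h1 : (1 : Fin 3) ∈ P <;> simp [Base3.qOf, Base3.dq, realEnv, insIf, h0, h1]

/-- the box state selected by a three-special pattern. [folklore] -/
theorem ts_realBox (M C : Finset (Sym2 V)) (a b : V) (w : Sym2 V) (γ : ↥M.powerset) (P : Finset (Fin 3)) :
    (realBox M C a b w γ).ts (decide ((2 : Fin 3) ∈ P)) = realSDat0 (insert w M) C a b (insIf ((2 : Fin 3) ∈ P) w γ.1) := by
  by_cases h2 : (2 : Fin 3) ∈ P <;> simp [Base.BDat.ts, realBox, realSDat, realSDat0, insIf, h2]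

/-- **`E₁ ∥ B` of real data is the real three-special environment of `E₁ ∪ E₂`** (pattern by pattern, levels raised by `2|V|`).
[cite: Grimmett2006, §3.8 (pp. 61–62)] -/
theorem gcombPar_real_d (h₂ : IsTTSP E₂ a b) (hd : Disjoint E₂ E₁)
    (hV : ∀ v : V, (∃ e ∈ E₂, v ∈ e) → (∃ e ∈ E₁, v ∈ e) → v = a ∨ v = b)
    (hM₁ : insert s(uy, vy) (insert s(uz, vz) M₁) ⊆ E₁) (hC₁ : C₁ ⊆ E₁) (hM₂ : insert w M₂ ⊆ E₂) (hC₂ : C₂ ⊆ E₂)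
    (β : ↥M₁.powerset) (γ : ↥M₂.powerset) (P : Finset (Fin 3)) :
    (Base3.gcombPar (realEnv M₁ C₁ a b s(uy, vy) s(uz, vz)) (realBox M₂ C₂ a b w) (β, γ)).d P =
      ⟨((realEnv3 (M₁ ∪ M₂) (C₁ ∪ C₂) a b s(uy, vy) s(uz, vz) w ⟨β.1 ∪ γ.1, Finset.mem_powerset.2
          (Finset.union_subset_union (Finset.mem_powerset.1 β.2) (Finset.mem_powerset.1 γ.2))⟩).d P).lam + 2 * Fintype.card V,
        ((realEnv3 (M₁ ∪ M₂) (C₁ ∪ C₂) a b s(uy, vy) s(uz, vz) w ⟨β.1 ∪ γ.1, Finset.mem_powerset.2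
          (Finset.union_subset_union (Finset.mem_powerset.1 β.2) (Finset.mem_powerset.1 γ.2))⟩).d P).k1,
        ((realEnv3 (M₁ ∪ M₂) (C₁ ∪ C₂) a b s(uy, vy) s(uz, vz) w ⟨β.1 ∪ γ.1, Finset.mem_powerset.2
          (Finset.union_subset_union (Finset.mem_powerset.1 β.2) (Finset.mem_powerset.1 γ.2))⟩).d P).k2⟩ := by
  have hβ : β.1 ⊆ M₁ := Finset.mem_powerset.1 β.2
  have hγ : γ.1 ⊆ M₂ := Finset.mem_powerset.1 γ.2
  show Base3.comb3 (Base3.dq (realEnv M₁ C₁ a b s(uy, vy) s(uz, vz) β) (Base3.qOf P))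
    ((realBox M₂ C₂ a b w γ).ts (decide ((2 : Fin 3) ∈ P))) = _
  rw [dq_realEnv_qOf, ts_realBox, comb3_eq_acomb, realEnv3_d]
  have hXA : insIf ((2 : Fin 3) ∈ P) w γ.1 ⊆ insert w M₂ := insIf_subset_insert _ hγ
  have hX : insIf ((0 : Fin 3) ∈ P) s(uy, vy) (insIf ((1 : Fin 3) ∈ P) s(uz, vz) β.1) ⊆ insert s(uy, vy) (insert s(uz, vz) M₁) :=
    insIf_subset_insert _ (insIf_subset_insert _ hβ)
  have hY : patSet3 s(uy, vy) s(uz, vz) w P (β.1 ∪ γ.1) =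
      insIf ((2 : Fin 3) ∈ P) w γ.1 ∪ insIf ((0 : Fin 3) ∈ P) s(uy, vy) (insIf ((1 : Fin 3) ∈ P) s(uz, vz) β.1) := by
    rw [union_insIf, union_insIf, insIf_union, Finset.union_comm γ.1 β.1]; rfl
  rw [acomb_realSDat0 h₂ hd hV hM₂ hC₂ hM₁ hC₁ hXA hX hY, Finset.insert_union, Finset.union_comm M₂ M₁, Finset.union_comm C₂ C₁]

end Data

section Facts

variable {E₁ E₂ M₁ C₁ M₂ C₂ : Finset (Sym2 V)} {a b uy vy uz vz uw vw : V}

/-- **THE FIVE FACTS FOR THE REAL PARALLEL 2+1 GLUING.**  `E₁, E₂` two-terminal series–parallel between `a, b`, edge-disjoint, vertex sets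
meeting only in `{a, b}`; `y, z ∈ E₁`, `w ∈ E₂`; cells `(M₁, C₁) ⊆ E₁ \ {y,z}`, `(M₂, C₂) ⊆ E₂ \ w`.  Then the real three-special environment
`realEnv3 (M₁ ∪ M₂) (C₁ ∪ C₂) a b y z w` satisfies the five facts of the generic word theorem (fact 1 = GLUE(2,1)∥).
[cite: Grimmett2006, §3.8 Thm. (3.90) (pp. 61–62)] [cite: Wagner2006, Thm. 5.8(d), §5.3] -/
theorem realEnv3_par21_facts (h₁ : IsTTSP E₁ a b) (h₂ : IsTTSP E₂ a b) (hd : Disjoint E₁ E₂)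
    (hV : ∀ v : V, (∃ e ∈ E₁, v ∈ e) → (∃ e ∈ E₂, v ∈ e) → v = a ∨ v = b)
    (hy : s(uy, vy) ∈ E₁) (hz : s(uz, vz) ∈ E₁) (hw : s(uw, vw) ∈ E₂) (hyz : s(uy, vy) ≠ s(uz, vz))
    (hM₁ : M₁ ⊆ (E₁.erase s(uy, vy)).erase s(uz, vz)) (hC₁ : C₁ ⊆ (E₁.erase s(uy, vy)).erase s(uz, vz)) (hMC₁ : Disjoint M₁ C₁)
    (hM₂ : M₂ ⊆ E₂.erase s(uw, vw)) (hC₂ : C₂ ⊆ E₂.erase s(uw, vw)) (hMC₂ : Disjoint M₂ C₂) :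
    (∀ h0 h1 : ↥(M₁ ∪ M₂).powerset → ℝ, Monotone h0 → Monotone h1 → (∀ γ, 0 ≤ h0 γ) → (∀ γ, h0 γ ≤ h1 γ) → ∀ J : ℤ,
        0 ≤ Gen.gMt (realEnv3 (M₁ ∪ M₂) (C₁ ∪ C₂) a b s(uy, vy) s(uz, vz) s(uw, vw)) h0 h1 J)
      ∧ (∀ h0 h1 : Bool × ↥(M₁ ∪ M₂).powerset → ℝ, Monotone h0 → Monotone h1 → (∀ p, 0 ≤ h0 p) → (∀ p, h0 p ≤ h1 p) → ∀ J : ℤ,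
        0 ≤ Gen.gMt (Gen.parE (realEnv3 (M₁ ∪ M₂) (C₁ ∪ C₂) a b s(uy, vy) s(uz, vz) s(uw, vw))) h0 h1 J)
      ∧ (∀ h : ↥(M₁ ∪ M₂).powerset → ℝ, Monotone h → (∀ γ, 0 ≤ h γ) → ∀ J : ℤ,
        0 ≤ ∑ γ, h γ * (realEnv3 (M₁ ∪ M₂) (C₁ ∪ C₂) a b s(uy, vy) s(uz, vz) s(uw, vw) γ).gandDel J)
      ∧ (∀ h : ↥(M₁ ∪ M₂).powerset → ℝ, Monotone h → (∀ γ, 0 ≤ h γ) → ∀ J : ℤ,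
        0 ≤ ∑ γ, h γ * (realEnv3 (M₁ ∪ M₂) (C₁ ∪ C₂) a b s(uy, vy) s(uz, vz) s(uw, vw) γ).gandCon J)
      ∧ (∀ h0 h1 : ↥(M₁ ∪ M₂).powerset → ℝ, Monotone h0 → Monotone h1 → (∀ γ, 0 ≤ h0 γ) → (∀ γ, h0 γ ≤ h1 γ) → ∀ J : ℤ,
          0 ≤ ∑ γ, (h1 γ * (realEnv3 (M₁ ∪ M₂) (C₁ ∪ C₂) a b s(uy, vy) s(uz, vz) s(uw, vw) γ).gandE1 J +
            h0 γ * (realEnv3 (M₁ ∪ M₂) (C₁ ∪ C₂) a b s(uy, vy) s(uz, vz) s(uw, vw) γ).gandE2 J)) := by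
  -- bookkeeping
  have hM₁E : M₁ ⊆ E₁ := hM₁.trans ((Finset.erase_subset _ _).trans (Finset.erase_subset _ _))
  have hC₁E : C₁ ⊆ E₁ := hC₁.trans ((Finset.erase_subset _ _).trans (Finset.erase_subset _ _))
  have hM₂E : M₂ ⊆ E₂ := hM₂.trans (Finset.erase_subset _ _)
  have hC₂E : C₂ ⊆ E₂ := hC₂.trans (Finset.erase_subset _ _)
  have hyM₁ : s(uy, vy) ∉ M₁ := fun h => (Finset.mem_erase.1 (Finset.mem_of_mem_erase (hM₁ h))).1 rfl
  have hzM₁ : s(uz, vz) ∉ M₁ := fun h => (Finset.mem_erase.1 (hM₁ h)).1 rfl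
  have hwM₂ : s(uw, vw) ∉ M₂ := fun h => (Finset.mem_erase.1 (hM₂ h)).1 rfl
  have hyw : s(uy, vy) ≠ s(uw, vw) := fun h => Finset.disjoint_left.1 hd hy (h ▸ hw)
  have hzw : s(uz, vz) ≠ s(uw, vw) := fun h => Finset.disjoint_left.1 hd hz (h ▸ hw)
  have hF : IsTTSP (E₁ ∪ E₂) a b := IsTTSP.parallel h₁ h₂ hd hV
  have hyF : s(uy, vy) ∈ E₁ ∪ E₂ := Finset.mem_union_left _ hy
  have hzF : s(uz, vz) ∈ E₁ ∪ E₂ := Finset.mem_union_left _ hz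
  have hwF : s(uw, vw) ∈ E₁ ∪ E₂ := Finset.mem_union_right _ hw
  have er3 : ∀ {e : Sym2 V}, e ∈ E₁ ∪ E₂ → e ≠ s(uy, vy) → e ≠ s(uz, vz) → e ≠ s(uw, vw) →
      e ∈ (((E₁ ∪ E₂).erase s(uy, vy)).erase s(uz, vz)).erase s(uw, vw) := fun he h1 h2 h3 =>
    Finset.mem_erase.2 ⟨h3, Finset.mem_erase.2 ⟨h2, Finset.mem_erase.2 ⟨h1, he⟩⟩⟩
  have in1 : ∀ {A : Finset (Sym2 V)}, A ⊆ (E₁.erase s(uy, vy)).erase s(uz, vz) →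
      A ⊆ (((E₁ ∪ E₂).erase s(uy, vy)).erase s(uz, vz)).erase s(uw, vw) := fun hA e he =>
    er3 (Finset.mem_union_left _ (Finset.mem_of_mem_erase (Finset.mem_of_mem_erase (hA he))))
      (Finset.mem_erase.1 (Finset.mem_of_mem_erase (hA he))).1 (Finset.mem_erase.1 (hA he)).1
      (fun h => Finset.disjoint_left.1 hd (Finset.mem_of_mem_erase (Finset.mem_of_mem_erase (hA he))) (h ▸ hw))
  have in2 : ∀ {A : Finset (Sym2 V)}, A ⊆ E₂.erase s(uw, vw) → A ⊆ (((E₁ ∪ E₂).erase s(uy, vy)).erase s(uz, vz)).erase s(uw, vw) :=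
    fun hA e he => er3 (Finset.mem_union_right _ (Finset.mem_of_mem_erase (hA he)))
      (fun h => Finset.disjoint_left.1 hd hy (h ▸ Finset.mem_of_mem_erase (hA he)))
      (fun h => Finset.disjoint_left.1 hd hz (h ▸ Finset.mem_of_mem_erase (hA he))) (Finset.mem_erase.1 (hA he)).1
  have hM : M₁ ∪ M₂ ⊆ (((E₁ ∪ E₂).erase s(uy, vy)).erase s(uz, vz)).erase s(uw, vw) := Finset.union_subset (in1 hM₁) (in2 hM₂)
  have hC : C₁ ∪ C₂ ⊆ (((E₁ ∪ E₂).erase s(uy, vy)).erase s(uz, vz)).erase s(uw, vw) := Finset.union_subset (in1 hC₁) (in2 hC₂)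
  have hMC : Disjoint (M₁ ∪ M₂) (C₁ ∪ C₂) := by
    rw [Finset.disjoint_union_left, Finset.disjoint_union_right, Finset.disjoint_union_right]
    exact ⟨⟨hMC₁, Finset.disjoint_of_subset_left hM₁E (Finset.disjoint_of_subset_right hC₂E hd)⟩,
      ⟨Finset.disjoint_of_subset_left hM₂E (Finset.disjoint_of_subset_right hC₁E hd.symm), hMC₂⟩⟩
  -- the abstract facts 1 and 2 of `E₁ ∥ B` on real data
  obtain ⟨f1, f2, -, f4, -⟩ := isTTSP_realEnv_facts h₁ hy hz hyz hM₁ hC₁ hMC₁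
  have hcE := fun β => realEnv_consistentP (C := C₁) (a := a) (b := b) hyM₁ hzM₁ hyz β
  have hcB := fun γ => realBox_consistent (C := C₂) (a := a) (b := b) hwM₂ γ
  have A1 : ∀ h0 h1 : ↥M₁.powerset × ↥M₂.powerset → ℝ, Monotone h0 → Monotone h1 → (∀ p, 0 ≤ h0 p) → (∀ p, h0 p ≤ h1 p) → ∀ J : ℤ,
      0 ≤ Gen.gMt (Base3.gcombPar (realEnv M₁ C₁ a b s(uy, vy) s(uz, vz)) (realBox M₂ C₂ a b s(uw, vw))) h0 h1 J :=
    fun h0 h1 m0 m1 n0 le J => Base3.gcombPar_gMt_nonneg _ _ hcE hcB f1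
      (fun h0 h1 m0 m1 n0 le K => Mt_parE_summed_nonneg f2 h0 h1 m0 m1 n0 le K) f4
      (fun h0 h1 m0 m1 _ le K => realEnv_pivotY h₁ hy hz hyz hM₁ hC₁ m0 m1 le K)
      (fun h0 h1 m0 m1 _ le K => realEnv_pivotZ h₁ hy hz hyz hM₁ hC₁ m0 m1 le K)
      (fun l0 h0 l1 h1 ml0 mh0 ml1 mh1 _ le0 le1 lel leh K => realEnv_exactY h₁ hy hz hyz hM₁ hC₁ ml0 mh0 ml1 mh1 le0 le1 lel leh K)
      (fun _ mh _ K => realBox_A1 h₂ hw hM₂ hC₂ mh K) (fun _ _ m0' m1' _ le' K => realBox_A3n h₂ hw hM₂ hC₂ m0' m1' le' K)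
      (fun _ _ m0' m1' _ le' K => realBox_A4n h₂ hw hM₂ hC₂ m0' m1' le' K) m0 m1 n0 le J
  have A2 : ∀ h0 h1 : Bool × (↥M₁.powerset × ↥M₂.powerset) → ℝ, Monotone h0 → Monotone h1 → (∀ p, 0 ≤ h0 p) → (∀ p, h0 p ≤ h1 p) →
      ∀ J : ℤ, 0 ≤ Gen.gMt (Gen.parE (Base3.gcombPar (realEnv M₁ C₁ a b s(uy, vy) s(uz, vz)) (realBox M₂ C₂ a b s(uw, vw)))) h0 h1 J :=
    fun h0 h1 m0 m1 n0 le J => Base3.gcombPar_parE_gMt_nonneg _ _ hcE hcB f1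
      (fun h0 h1 m0 m1 n0 le K => Mt_parE_summed_nonneg f2 h0 h1 m0 m1 n0 le K) f4
      (fun h0 h1 m0 m1 _ le K => realEnv_pivotY h₁ hy hz hyz hM₁ hC₁ m0 m1 le K)
      (fun h0 h1 m0 m1 _ le K => realEnv_pivotZ h₁ hy hz hyz hM₁ hC₁ m0 m1 le K)
      (fun l0 h0 l1 h1 ml0 mh0 ml1 mh1 _ le0 le1 lel leh K => realEnv_exactY h₁ hy hz hyz hM₁ hC₁ ml0 mh0 ml1 mh1 le0 le1 lel leh K)
      (fun _ mh _ K => realBox_A1 h₂ hw hM₂ hC₂ mh K) (fun _ _ m0' m1' _ le' K => realBox_A3n h₂ hw hM₂ hC₂ m0' m1' le' K)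
      (fun _ _ m0' m1' _ le' K => realBox_A4n h₂ hw hM₂ hC₂ m0' m1' le' K) m0 m1 n0 le J
  -- transport along `(β, γ) ↦ β ∪ γ`
  have hdM : Disjoint M₁ M₂ := Finset.disjoint_of_subset_left hM₁E (Finset.disjoint_of_subset_right hM₂E hd)
  let φ : ↥M₁.powerset × ↥M₂.powerset ≃ ↥(M₁ ∪ M₂).powerset :=
    { toFun := fun p => ⟨p.1.1 ∪ p.2.1, Finset.mem_powerset.2
        (Finset.union_subset_union (Finset.mem_powerset.1 p.1.2) (Finset.mem_powerset.1 p.2.2))⟩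
      invFun := fun δ => (⟨δ.1 ∩ M₁, Finset.mem_powerset.2 Finset.inter_subset_right⟩,
        ⟨δ.1 ∩ M₂, Finset.mem_powerset.2 Finset.inter_subset_right⟩)
      left_inv := fun p => by
        obtain ⟨⟨X, hX⟩, ⟨Y, hY⟩⟩ := p
        have hX' := Finset.mem_powerset.1 hX; have hY' := Finset.mem_powerset.1 hY
        refine Prod.ext (Subtype.ext ?_) (Subtype.ext ?_)
        · show (X ∪ Y) ∩ M₁ = X
          rw [Finset.union_inter_distrib_right, Finset.inter_eq_left.2 hX',
            Finset.disjoint_iff_inter_eq_empty.1 (Finset.disjoint_of_subset_left hY' hdM.symm), Finset.union_empty]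
        · show (X ∪ Y) ∩ M₂ = Y
          rw [Finset.union_inter_distrib_right, Finset.inter_eq_left.2 hY',
            Finset.disjoint_iff_inter_eq_empty.1 (Finset.disjoint_of_subset_left hX' hdM), Finset.empty_union]
      right_inv := fun δ => Subtype.ext (by
        show δ.1 ∩ M₁ ∪ δ.1 ∩ M₂ = δ.1
        rw [← Finset.inter_union_distrib_left, Finset.inter_eq_left.2 (Finset.mem_powerset.1 δ.2)]) }
  have hφ : Monotone φ := fun p q hpq => show (φ p).1 ⊆ (φ q).1 from Finset.union_subset_union hpq.1 hpq.2
  have hd' : ∀ (p : ↥M₁.powerset × ↥M₂.powerset) (P : Finset (Fin 3)),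
      (realEnv3 (M₁ ∪ M₂) (C₁ ∪ C₂) a b s(uy, vy) s(uz, vz) s(uw, vw) (φ p)).d P =
        ⟨((Base3.gcombPar (realEnv M₁ C₁ a b s(uy, vy) s(uz, vz)) (realBox M₂ C₂ a b s(uw, vw)) p).d P).lam + (-(2 * (Fintype.card V : ℤ))),
          ((Base3.gcombPar (realEnv M₁ C₁ a b s(uy, vy) s(uz, vz)) (realBox M₂ C₂ a b s(uw, vw)) p).d P).k1,
          ((Base3.gcombPar (realEnv M₁ C₁ a b s(uy, vy) s(uz, vz)) (realBox M₂ C₂ a b s(uw, vw)) p).d P).k2⟩ := by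
    rintro ⟨β, γ⟩ P
    exact PDat.eq_of_addLam (gcombPar_real_d h₂ hd.symm (fun v h2 h1 => hV v h1 h2)
      (Finset.insert_subset hy (Finset.insert_subset hz hM₁E)) hC₁E (Finset.insert_subset hw hM₂E) hC₂E β γ P)
  refine ⟨?_, ?_, ?_, ?_, ?_⟩
  · exact fun H0 H1 m0 m1 n0 le J =>
      Gen.gtransfer_Mt hφ (fun p J => ⟨(Gen.gtransfer_hs hd' p J).1, (Gen.gtransfer_hs hd' p J).2.1⟩) A1 H0 H1 m0 m1 n0 le J
  · exact fun H0 H1 m0 m1 n0 le J => Gen.gtransfer_parE hφ hd' A2 H0 H1 m0 m1 n0 le J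
  · exact fun h mh _ J => realEnv3_andDel_nonneg hF hyF hzF hwF hyz hyw hzw hM hC hMC mh J
  · exact fun h mh _ J => realEnv3_andCon_nonneg hF hyF hzF hwF hyz hyw hzw hM hC hMC mh J
  · exact fun h0 h1 m0 m1 _ le J => realEnv3_andFree_nonneg hF hyF hzF hwF hyz hyw hzw hM hC hMC m0 m1 le J

end Facts

end RootForm

end FK

end Summit.CriticalPhenomena.PercolationContinuityZ3.Theorems

end
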